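import Summits.HubbardSuperconductivity.HubbardSuperconductivity.Theorems.BalabanIRBirComplexStableXYRCovarianceFRDGradient
import HarnessLib

/-!
# Crux `BirComplexStableXYR` (stmt-HubbardSuperconductivity-14845): MILESTONE M1, part 4 —
# power-law DECAY of the gradients of the (scale-truncated) reference covariance, volume-uniformly

Support file (prover seat 1, route BalabanIR), continuation of `…CovarianceFRDGradient.lean`.  Summing
the single-shell gradient bounds `|∇_l C^{(m)}_N(x,y)| ≤ K·2^{−N(k+1)}` (`k = |l| ≤ 2m − 2`) over the
scales `2^N ≤ L, M` and using the FINITE RANGE of the pieces (`≤ 2m·2^N·3(r−1)` in the torus `ℓ¹`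
metric) gives the lattice power law that every single- or multi-scale expansion around the Gaussian
backbone consumes (line card §2(b): "lines between vertices carry `∇∇C(x,y) ~ |x−y|⁻³`"):

* **`birHessian_covarianceFRD_decay`** (registered stub of this seat on the crux item): for a table with
  (N), (C) (`c₀ > 0`, `r ≥ 2`), every torus `(ℤ/L)²×ℤ/M`, every `m`, every number of scales `J` with
  `2^N ≤ L, M` for all `N < J`, every list `l` of `k ≤ 2m − 2` unit steps `±E_i` and all sites `x ≠ y`,
  `|∇_l (Σ_{N<J} C^{(m)}_N)(x,y)| ≤ 2K(m,k,4c₀/Λ_c)·(24 m r (k+1))^{k+1} / d(x,y)^{k+1}`,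
  `d` the torus `ℓ¹` distance: the `k`-th gradient of the truncated covariance decays like
  `|x−y|^{−(1+k)}` (`d_eff = 3`), UNIFORMLY IN THE VOLUME — in particular the dipole kernel (`k = 2`)
  like `|x−y|⁻³`.
* ingredients: `cfrd_tdist_step` (the `ℓ¹` distance moves by at most one under a unit step),
  `cfrd_rowDiffs_frdPiecePow_eq_zero` (pieces beyond their range do not contribute),
  `geomTail_le` (`Σ_{N∈S} q^N ≤ 2q^{N₀}` for `q ≤ ½`, `S ⊆ [N₀,∞)`).

No definitions; sorry-free. [folklore]
-/

noncomputable section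

namespace Summit.HubbardSuperconductivity.HubbardSuperconductivity.Theorems

set_option linter.dupNamespace false -- summit = problem name (single-conjunct summit), D-0017

open scoped BigOperators Matrix ComplexConjugate
open Complex Summit.HubbardSuperconductivity.BirComplexStableXYNegative
open Literature.Probability.LatticeModels Literature.Analysis.Matrix Literature.Analysis.Fourier

section CovarianceFRDDecay

variable {r : ℕ} {L M : ℕ} [NeZero L] [NeZero M]

-- The window linear form `a_{(s,n)}(j) = Σ_w n_w [sh s w = j]` (local abbreviation).
set_option quotPrecheck false in
local notation "aform[" L' "," M' "](" s "," n "," j ")" =>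
  ∑ w, (((n w : ℤ) : ℝ) * (if sh L' M' s w = j then (1 : ℝ) else 0))

-- The inline Hessian matrix of `Q_c` (local abbreviation).
set_option quotPrecheck false in
local notation "Hm[" c' "," L' "," M' "]" => (Matrix.of fun i j : Λ L' M' =>
  (-(∑ k : Λ L' M' × ↥((c' : Table _).support),
    (c' : Table _) k.2 * ((aform[L',M'](k.1, k.2.1, i) : ℝ) : ℂ)
      * ((aform[L',M'](k.1, k.2.1, j) : ℝ) : ℂ))).re)

-- the torus `ℓ¹` distance (local abbreviation; inline in statements)
set_option quotPrecheck false in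
local notation "tdist[" L' "," M' "]" => (fun i j : Λ L' M' =>
  ((j.1 0 - i.1 0).valMinAbs.natAbs + (j.1 1 - i.1 1).valMinAbs.natAbs + (j.2 - i.2).valMinAbs.natAbs))

-- the three unit steps of the space-time torus (local abbreviation; inline in statements)
set_option quotPrecheck false in
local notation "Evec[" L' "," M' "]" =>
  (![((![1, 0] : Literature.Probability.LatticeModels.TorusSite 2 L'), (0 : ZMod M')), (![0, 1], 0), (0, 1)]
    : Fin 3 → Λ L' M')

/-! ## A geometric tail -/

omit [NeZero L] [NeZero M] in
/-- `Σ_{N∈S} q^N ≤ 2·q^{N₀}` for `0 ≤ q ≤ ½` and a finite set `S ⊆ [N₀, ∞)`. [folklore] -/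
theorem geomTail_le {q : ℝ} (hq0 : 0 ≤ q) (hq : q ≤ 1 / 2) (S : Finset ℕ) (N₀ : ℕ) (hS : ∀ N ∈ S, N₀ ≤ N) :
    ∑ N ∈ S, q ^ N ≤ 2 * q ^ N₀ := by
  set B := S.sup id + 1 with hB
  have hsub : S ⊆ Finset.Ico N₀ B := by
    intro N hN
    rw [Finset.mem_Ico]
    exact ⟨hS N hN, Nat.lt_succ_of_le (Finset.le_sup (f := id) hN)⟩
  calc ∑ N ∈ S, q ^ N ≤ ∑ N ∈ Finset.Ico N₀ B, q ^ N :=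
        Finset.sum_le_sum_of_subset_of_nonneg hsub fun N _ _ => pow_nonneg hq0 N
    _ = ∑ i ∈ Finset.range (B - N₀), q ^ (N₀ + i) := by
        rw [Finset.sum_Ico_eq_sum_range]
    _ = q ^ N₀ * ∑ i ∈ Finset.range (B - N₀), q ^ i := by
        rw [Finset.mul_sum]; exact Finset.sum_congr rfl fun i _ => pow_add _ _ _
    _ ≤ q ^ N₀ * ∑ i ∈ Finset.range (B - N₀), (1 / 2 : ℝ) ^ i := by
        gcongr
    _ ≤ q ^ N₀ * 2 := by
        gcongr
        exact sum_geometric_two_le _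
    _ = 2 * q ^ N₀ := by ring

/-! ## The torus `ℓ¹` distance under a unit step -/

omit [NeZero M] in
/-- `|1|_L ≤ 1` for the centred residue. [folklore] -/
theorem cfrd_natAbs_valMinAbs_one_le : ((1 : ZMod L)).valMinAbs.natAbs ≤ 1 := by
  simpa using cfrd_valMinAbs_natCast_sub_le (n := L) (r := 2) 1 0 (by norm_num) (by norm_num)

/-- A unit step `±E_i` has `ℓ¹` length `≤ 1`. [folklore] -/
theorem cfrd_tdist_unitStep_le (i : Fin 3) (x : Λ L M) :
    tdist[L,M] x (x + Evec[L,M] i) ≤ 1 ∧ tdist[L,M] x (x + -(Evec[L,M] i)) ≤ 1 := by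
  have h1L := cfrd_natAbs_valMinAbs_one_le (L := L)
  have h1M := cfrd_natAbs_valMinAbs_one_le (L := M)
  fin_cases i <;> constructor <;>
    simp [Prod.fst_add, Prod.snd_add, Pi.add_apply, ZMod.valMinAbs_zero, h1L, h1M, sub_eq_add_neg]

/-- **The torus `ℓ¹` distance moves by at most one under a unit step** `±E_i` of the first argument.
[folklore] -/
theorem cfrd_tdist_step (g : Λ L M) (hg : ∃ i : Fin 3, g = Evec[L,M] i ∨ g = -(Evec[L,M] i)) (x y : Λ L M) :
    tdist[L,M] x y ≤ tdist[L,M] (x + g) y + 1 := by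
  have htri := cfrd_tdist_triangle x (x + g) y
  have hstep : tdist[L,M] x (x + g) ≤ 1 := by
    obtain ⟨i, rfl | rfl⟩ := hg
    · exact (cfrd_tdist_unitStep_le i x).1
    · exact (cfrd_tdist_unitStep_le i x).2
  simp only at htri hstep ⊢
  omega

/-! ## Pieces beyond their range do not contribute -/

/-- The `l`-fold difference of the piece `C^{(m)}_N` (of `t•H`, any `t`) vanishes at `(x,y)` as soon as
`d(x,y) > 2m·2^N·3(r−1) + |l|` (finite range of the piece plus one unit per difference). [folklore] -/
theorem cfrd_rowDiffs_frdPiecePow_eq_zero (c : Table r) (t : ℝ) (m N : ℕ)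
    (l : List (Λ L M)) (hl : ∀ g ∈ l, ∃ i : Fin 3, g = Evec[L,M] i ∨ g = -(Evec[L,M] i)) {x y : Λ L M}
    (hxy : 2 * m * 2 ^ N * (3 * (r - 1)) + l.length < tdist[L,M] x y) :
    rowDiffs l (frdPiecePow (t • Hm[c,L,M]) m N) x y = 0 :=
  (cfrd_hasFiniteRange_frdPiecePow c t m N).rowDiffs_apply_eq_zero l
    (fun g hg x' y' => cfrd_tdist_step g (hl g hg) x' y') hxy

/-! ## The decay of the gradients of the truncated covariance (registered stub) -/

/-- **MILESTONE M1, part 4 — power-law decay of the gradients of the scale-truncated reference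
covariance, volume-uniformly (registered stub `birHessian_covarianceFRD_decay` of prover seat 1 on
crux 2R).**  `|∇_l(Σ_{N<J} C^{(m)}_N)(x,y)| ≤ 2K(m,k,4c₀/Λ_c)(24mr(k+1))^{k+1}/d(x,y)^{k+1}` for
`x ≠ y`, `k = |l| ≤ 2m − 2`, `2^N ≤ L, M` for all `N < J`. [folklore] -/
theorem birHessian_covarianceFRD_decay : ∀ (r : ℕ) (c : Table r) (c₀ : ℝ), 2 ≤ r → 0 < c₀ → c.sum (fun _ a => a) = 0 → (∀ φ : W r → ℝ, c₀ * ∑ w, ∑ w', (1 - Real.cos (φ w - φ w')) ≤ (genF c φ).re) → ∀ (L M : ℕ) [NeZero L] [NeZero M] (m J : ℕ), (∀ N, N < J → 2 ^ N ≤ L ∧ 2 ^ N ≤ M) → ∀ (l : List (Λ L M)), (∀ g ∈ l, ∃ i : Fin 3, g = (![((![1, 0] : Literature.Probability.LatticeModels.TorusSite 2 L), (0 : ZMod M)), (![0, 1], 0), (0, 1)] : Fin 3 → Λ L M) i ∨ g = -((![((![1, 0] : Literature.Probability.LatticeModels.TorusSite 2 L), (0 : ZMod M)), (![0, 1], 0),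 (0, 1)] : Fin 3 → Λ L M) i)) → l.length + 2 ≤ 2 * m → ∀ x y : Λ L M, x ≠ y → |Literature.Analysis.Fourier.rowDiffs l (∑ N ∈ Finset.range J, Literature.Analysis.Matrix.frdPiecePow ((4 / (2 * normA c * (r : ℝ) ^ 3)) • (Matrix.of fun i j : Λ L M => (-(∑ k : Λ L M × ↥c.support, c k.2 * ((∑ w, ((k.2 : Freq r) w : ℝ) * (if sh L M k.1 w = i then (1 : ℝ) else 0) : ℝ) : ℂ) * ((∑ w, ((k.2 : Freq r) w : ℝ) * (if sh L M k.1 w = j then (1 : ℝ) else 0) : ℝ) : ℂ))).re)) m N) x y| ≤ 2 * (27 * m * (2 * Real.pi) ^ l.length / 4 * (1 + 2 ^ (l.length + 4) * Real.pi ^ (2 * m + 2) / (16 * (4 * c₀ / (2 * normA c * (r : ℝ) ^ 3))) ^ (m + 1))) * (24 * m * r * (l.length + 1)) ^ (l.length + 1) / (((y.1 0 - x.1 0).valMinAbs.natAbs + (y.1 1 - x.1 1).valMinAbs.natAbs + (y.2 - x.2).valMinAbs.natAbs : ℕ) : ℝ) ^ (l.length + 1) := by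
  intro r c c₀ hr hc₀ hN hC L M _ _ m J hJ l hl hkm x y hxy
  -- abbreviations
  set k := l.length with hk
  set K : ℝ := 27 * m * (2 * Real.pi) ^ k / 4
      * (1 + 2 ^ (k + 4) * Real.pi ^ (2 * m + 2) / (16 * (4 * c₀ / (2 * normA c * (r : ℝ) ^ 3))) ^ (m + 1))
    with hKdef
  have hK0 : 0 ≤ K := by
    have := cfrd_scale_pos hr c hc₀ hC
    rw [hKdef]; positivity
  set D : ℕ := tdist[L,M] x y with hDdef
  have hm1 : 1 ≤ m := by omega
  have hr1 : (1 : ℝ) ≤ r := by exact_mod_cast (show 1 ≤ r by omega)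
  -- `D ≥ 1` since `x ≠ y`
  have hD1 : 1 ≤ D := by
    by_contra h0
    push Not at h0
    have h0' : D = 0 := by omega
    apply hxy
    rw [hDdef] at h0'
    simp only [Nat.add_eq_zero_iff, Int.natAbs_eq_zero, ZMod.valMinAbs_eq_zero, sub_eq_zero] at h0'
    obtain ⟨⟨h00, h01⟩, h02⟩ := h0'
    refine Prod.ext (funext fun a => ?_) h02.symm
    fin_cases a
    · exact h00.symm
    · exact h01.symm
  have hDpos : (0 : ℝ) < D := by exact_mod_cast hD1
  -- Step 1: the sum of pieces, difference by difference
  have hsum : rowDiffs l (∑ N ∈ Finset.range J, frdPiecePow ((4 / (2 * normA c * (r : ℝ) ^ 3)) • Hm[c,L,M]) m N) x y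
      = ∑ N ∈ Finset.range J, rowDiffs l (frdPiecePow ((4 / (2 * normA c * (r : ℝ) ^ 3)) • Hm[c,L,M]) m N) x y := by
    rw [rowDiffs_sum, Matrix.sum_apply]
  -- Step 2: only the scales `N` with `D ≤ 6m(r−1)2^N + k` contribute, each at most `K/2^{N(k+1)}`
  set S := (Finset.range J).filter (fun N => D ≤ 2 * m * 2 ^ N * (3 * (r - 1)) + k) with hSdef
  have hvanish : ∀ N ∈ Finset.range J, N ∉ S →
      rowDiffs l (frdPiecePow ((4 / (2 * normA c * (r : ℝ) ^ 3)) • Hm[c,L,M]) m N) x y = 0 := by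
    intro N hN hNS
    apply cfrd_rowDiffs_frdPiecePow_eq_zero c _ m N l hl
    rw [hSdef, Finset.mem_filter, not_and] at hNS
    have := hNS hN
    rw [← hDdef]; omega
  have hterm : ∀ N ∈ S,
      |rowDiffs l (frdPiecePow ((4 / (2 * normA c * (r : ℝ) ^ 3)) • Hm[c,L,M]) m N) x y|
        ≤ K * ((1 / 2) ^ (k + 1)) ^ N := by
    intro N hNS
    have hNJ : N < J := Finset.mem_range.mp (Finset.mem_filter.mp hNS).1
    have h := cfrd_frdPiecePow_gradient hr c hc₀ hN hC m N (hJ N hNJ).1 (hJ N hNJ).2 l hl hkm x y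
    rw [← hk, ← hKdef] at h
    refine h.trans (le_of_eq ?_)
    rw [← pow_mul, ← pow_mul, mul_comm (k + 1) N, one_div_pow, mul_one_div]
  have hbound : |rowDiffs l (∑ N ∈ Finset.range J, frdPiecePow ((4 / (2 * normA c * (r : ℝ) ^ 3)) • Hm[c,L,M]) m N) x y|
      ≤ K * ∑ N ∈ S, ((1 / 2 : ℝ) ^ (k + 1)) ^ N := by
    rw [hsum, ← Finset.sum_filter_of_ne (p := fun N => N ∈ S) (fun N hN hne => by
      by_contra hNS; exact hne (hvanish N hN hNS))]
    have hfilt : (Finset.range J).filter (fun N => N ∈ S) = S := by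
      ext N; simp [hSdef]
    rw [hfilt, Finset.mul_sum]
    exact (Finset.abs_sum_le_sum_abs _ _).trans (Finset.sum_le_sum fun N hN => hterm N hN)
  -- Step 3: the geometric tail, in the two regimes of `D`
  have hq0 : (0 : ℝ) ≤ (1 / 2) ^ (k + 1) := by positivity
  have hq : ((1 / 2 : ℝ)) ^ (k + 1) ≤ 1 / 2 := by
    calc ((1 / 2 : ℝ)) ^ (k + 1) ≤ (1 / 2) ^ 1 := pow_le_pow_of_le_one (by norm_num) (by norm_num) (by omega)
      _ = 1 / 2 := pow_one _
  -- the target constant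
  set T : ℝ := 24 * m * r * (k + 1) with hTdef
  have hm1' : (1 : ℝ) ≤ m := by exact_mod_cast hm1
  have hmr : (1 : ℝ) ≤ (m : ℝ) * r := one_le_mul_of_one_le_of_one_le hm1' hr1
  have hmr0 : (0 : ℝ) ≤ (m : ℝ) * r := zero_le_one.trans hmr
  have hk0 : (0 : ℝ) ≤ k := Nat.cast_nonneg k
  -- `24(k+1) ≤ T` and `12 m r ≤ T`
  have hT24 : 24 * ((k : ℝ) + 1) ≤ T := by rw [hTdef]; nlinarith
  have hT12 : 12 * (m : ℝ) * r ≤ T := by rw [hTdef]; nlinarith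
  by_cases hsmall : D ≤ 2 * k + 1
  · -- trivial regime: `Σ ≤ 2K ≤ 2K (T/D)^{k+1}`
    have h1 : ∑ N ∈ S, ((1 / 2 : ℝ) ^ (k + 1)) ^ N ≤ 2 := by
      have := geomTail_le hq0 hq S 0 (fun N _ => Nat.zero_le N)
      simpa using this
    have hTD : (1 : ℝ) ≤ T / D := by
      rw [le_div_iff₀ hDpos, one_mul]
      have hDle : (D : ℝ) ≤ 2 * k + 1 := by exact_mod_cast hsmall
      linarith
    calc |rowDiffs l (∑ N ∈ Finset.range J, frdPiecePow ((4 / (2 * normA c * (r : ℝ) ^ 3)) • Hm[c,L,M]) m N) x y|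
        ≤ K * 2 := hbound.trans (mul_le_mul_of_nonneg_left h1 hK0)
      _ ≤ K * 2 * (T / D) ^ (k + 1) := le_mul_of_one_le_right (by positivity) (one_le_pow₀ hTD)
      _ = 2 * K * T ^ (k + 1) / (D : ℝ) ^ (k + 1) := by rw [div_pow]; ring
  · -- decaying regime: every contributing scale has `2^N ≥ (D − k)/(6m(r−1)) ≥ D/(12mr)`
    push Not at hsmall
    by_cases hS0 : S = ∅
    · rw [hS0, Finset.sum_empty, mul_zero] at hbound
      exact hbound.trans (by positivity)
    obtain ⟨N₀, hN₀S, hN₀min⟩ := S.exists_min_image id (Finset.nonempty_iff_ne_empty.mpr hS0)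
    have h1 : ∑ N ∈ S, ((1 / 2 : ℝ) ^ (k + 1)) ^ N ≤ 2 * (((1 / 2 : ℝ) ^ (k + 1)) ^ N₀) :=
      geomTail_le hq0 hq S N₀ fun N hN => hN₀min N hN
    -- `2^{N₀} ≥ D/(12 m r)` from `N₀ ∈ S`
    have hN₀P : D ≤ 2 * m * 2 ^ N₀ * (3 * (r - 1)) + k := (Finset.mem_filter.mp hN₀S).2
    have hpow : (D : ℝ) ≤ 12 * m * r * (2 : ℝ) ^ N₀ := by
      have hr2 : 1 ≤ r := by omega
      have h' : D ≤ 2 * (2 * m * 2 ^ N₀ * (3 * (r - 1))) := by omega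
      have h'' : (D : ℝ) ≤ 2 * (2 * m * 2 ^ N₀ * (3 * ((r : ℝ) - 1))) := by
        have := (Nat.cast_le (α := ℝ)).mpr h'
        push_cast [Nat.cast_sub hr2] at this
        exact this
      have hm0 : (0 : ℝ) ≤ m := Nat.cast_nonneg m
      have h2N : (0 : ℝ) ≤ (m : ℝ) * (2 : ℝ) ^ N₀ := mul_nonneg hm0 (pow_pos (by norm_num) N₀).le
      nlinarith [h2N]
    -- hence `(1/2^{k+1})^{N₀} ≤ (12mr/D)^{k+1}`
    have hratio : ((1 / 2 : ℝ) ^ (k + 1)) ^ N₀ ≤ (12 * m * r / D) ^ (k + 1) := by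
      rw [← pow_mul, mul_comm (k + 1) N₀, pow_mul, one_div_pow]
      apply pow_le_pow_left₀ (by positivity)
      rw [div_le_div_iff₀ (by positivity) hDpos, one_mul]
      exact hpow
    calc |rowDiffs l (∑ N ∈ Finset.range J, frdPiecePow ((4 / (2 * normA c * (r : ℝ) ^ 3)) • Hm[c,L,M]) m N) x y|
        ≤ K * (2 * (12 * m * r / D) ^ (k + 1)) :=
          hbound.trans (mul_le_mul_of_nonneg_left (h1.trans (by gcongr)) hK0)
      _ ≤ K * (2 * (T / D) ^ (k + 1)) := by
          gcongr
      _ = 2 * K * T ^ (k + 1) / (D : ℝ) ^ (k + 1) := by rw [div_pow]; ring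

end CovarianceFRDDecay

end Summit.HubbardSuperconductivity.HubbardSuperconductivity.Theorems

end
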